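import Summits.BirchSwinnertonDyer.BirchSwinnertonDyer.Theorems.SignedLowerHalvesKobayashiLowerHalfSemistableScope
import Summits.BirchSwinnertonDyer.Rank1Residual.Supersingular.KobayashiMainConjectureX6BSTWScopeThree
import Summits.BirchSwinnertonDyer.Rank1Residual.SecondDescent.CanaryTargetsClassCertificates
import Mathlib.Tactic.NormNum.LegendreSymbol
import HarnessLib

/-!
# Route `SignedLowerHalves`, crux `KobayashiLowerHalfSemistable` (item stmt-BirchSwinnertonDyer-19000): kernel-checked
# scope witnesses at `p = 3` for the A6 cells `4343b1`, `4963c1`, `5561a1`, `8710b1` and their Eisenstein halves MODULO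
# ONLY the `p = 3` tier binder (cell `bsd-ssimc`, seat `bsd-ssimc-k3-c2` gen 2; companion B of
# `…SemistableScopeThree.lean`; a `--supports … --as helper` file, closes nothing)

PARTITION (cell bsd-ssimc): X6 ∧ r = 0 (A6) × the 12 cells at `p = 3` (`a₃ = 0`; here 4343b1, 4963c1, 5561a1, 8710b1) —
types-the-object-of; closes NONE. THEOREMS ONLY. HONEST FRAMING: nothing here is a theorem about Kobayashi's
conjecture; the conditional theorems are MODULO the named OPEN binder
`Summit.BirchSwinnertonDyer.Rank1Residual.Supersingular.BurungaleSkinnerTianWan2024_thm13_scopedAtThree_OPEN` (source: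
the PREPRINT arXiv:2409.01350v2 resting at `p = 3` on the preprint [SV-S-Ohta], located residual (3-ii)♭,
REPORT-bstw-7 40fdbe7e627732c4); the witnesses themselves are UNCONDITIONAL kernel facts about explicit integers;
BSD is not proved by any of this; the crux stays OPEN; nothing is booked (RELAY-6).

Per cell (gen 0's F3 pattern, see `…SemistableScope.lean`): `#Ẽ(𝔽₃) = 4` (kernel count), `ClassX6 W 3` by cc-eng-4's
`classX6_three_of_intModel`, the scope witness `BSTWScope.HasWitness W 3` from decidable data via
`BSTWScope.hasWitness_of_kronecker` (bad primes confined by a factorisation certificate of `Δ`; the (ram) prime by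
Tate; Kronecker symbols by `norm_num`; the form class number `h(−D)` by `decide`), and `KobayashiLowerDivisibility W 3 ε`
for both signs modulo only the tier binder. Cells: `4343b1` (`q = 43`, `L = ℚ(√−47)`, `h = 5`), `4963c1` (`q = 7`, `L = ℚ(√−95)`, `h = 8`), `5561a1` (`q = 67`, `L = ℚ(√−47)`, `h = 5`), `8710b1` (`q = 13`, `L = ℚ(√−119)`, `h = 10`).
Witness table: seat folder `scripts/p3_witnesses.json` (generator `scripts/gen_p3_witness_lean.py`, pure python < 1 s).

References: [BurungaleSkinnerTianWan2024] Thm 1.3, II §2.3 (PRE); [Kobayashi2003] Conjecture (p. 2); [Cox2013] Thm 2.13 /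
7.7(ii); [Cremona2006] Table 1; [SilvermanAEC2009] VII.5 Prop. 5.1.
-/

set_option autoImplicit false
set_option linter.dupNamespace false

noncomputable section

open scoped Classical

open WeierstrassCurve NumberField Literature.NumberTheory.EllipticCurves
  Literature.NumberTheory.EllipticCurves.Rank1Residual
  Literature.NumberTheory.EllipticCurves.Rank1Residual.X11RankOneCertificates
  Summit.BirchSwinnertonDyer.Rank1Residual.Supersingular
  Summit.BirchSwinnertonDyer.Rank1Residual.SecondDescent
  Summit.BirchSwinnertonDyer.Rank1Residual.X11b
  Summit.BirchSwinnertonDyer.BirchSwinnertonDyer.Rank1Residual.IntModel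

namespace Summit.BirchSwinnertonDyer.BirchSwinnertonDyer.Theorems

/-! ### `4343b1 @ 3` -/

/-- `#Ẽ(𝔽₃) = 4` for `4343b1` (`a₃ = 0`: good SUPERSINGULAR at `3`, and the X6 clause at `p = 3`; kernel count). [folklore] -/
theorem card_c4343b1_3 :
    Nat.card (((⟨0, 0, 1, -325259, -71398995⟩ : WeierstrassCurve ℤ).map
      (Int.castRingHom (ZMod 3))).toAffine.Point) = 4 :=
  natCard_point_eq_of_countPoints 0 0 1 (-325259) (-71398995) 3 (by norm_num) (by decide +kernel)
    (by decide +kernel)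

/-- `ClassX6 W 3` for `4343b1` read off the integer model (`3 ∤ Δ`, `#Ẽ(𝔽₃) = 4`, `gcd(Δ, c₄) = 1`) by cc-eng-4's
`classX6_three_of_intModel`. [cite: Cremona2006, Table 1 (Cremona label 4343b1)] [cite: SilvermanAEC2009, VII.5 Prop. 5.1(a) and (b)] -/
theorem classX6_c4343b1_3 {W : WeierstrassCurve ℚ} [W.IsElliptic] [W.IsGloballyMinimal]
    (hWeq : W = ⟨0, 0, 1, -325259, -71398995⟩) : ClassX6 W 3 := by
  have hIW : integralModelInt W = ⟨0, 0, 1, -325259, -71398995⟩ :=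
    integralModelInt_eq_of_map_eq _ (by rw [hWeq]; ext <;> simp [WeierstrassCurve.map])
  exact classX6_three_of_intModel hIW (by decide +kernel) card_c4343b1_3 (by decide +kernel)

/-- **L-witness for `4343b1` at `p = 3`: `q = 43`, `L = ℚ(√−47)` (`h = 5`).** `4343b1 = [0, 0, 1, -325259, -71398995]` (Cremona's minimal model),
`N = 43·101`, `Δ_min = 43^2·101`; the (ram) prime at `3` is `q = 43` (`ord_43 Δ = 2`, `3 ∤ 2`); `−47` is a prime
fundamental discriminant `≡ 1 (mod 8)` with `(−47/ℓ) = +1` for `ℓ ∈ {3, 101}` (split: `3` and the primes of `N/43`),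
`(−47/43) = −1` (inert), `(47, 6N) = 1`, and `h(−47) = 5`, `3 ∤ 5` (form class number by `decide`). Hence
`BSTWScope.HasWitness W 3`. Unconditional; per pair; closes nothing.
[cite: Cremona2006, Table 1 (Cremona label 4343b1)] [cite: Cox2013, Thm. 2.13 (h(−47) = 5 by reduced forms)] -/
theorem BSTWScope_hasWitness_c4343b1_3 {W : WeierstrassCurve ℚ} [W.IsElliptic] [W.IsGloballyMinimal]
    (hWeq : W = ⟨0, 0, 1, -325259, -71398995⟩) : BSTWScope.HasWitness W 3 := by
  haveI h43 : Fact (Nat.Prime 43) := ⟨by norm_num⟩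
  have hIW : integralModelInt W = ⟨0, 0, 1, -325259, -71398995⟩ :=
    integralModelInt_eq_of_map_eq _ (by rw [hWeq]; ext <;> simp [WeierstrassCurve.map])
  set Lp : List ℕ := [43, 101] with hLp
  have hLprime : ∀ q ∈ Lp, q.Prime := by
    simp only [hLp, List.mem_cons, List.mem_nil_iff, or_false]
    rintro q (rfl | rfl) <;> norm_num
  have hΔE : ∀ q : ℕ, q.Prime → (q : ℤ) ∣ (⟨0, 0, 1, -325259, -71398995⟩ : WeierstrassCurve ℤ).Δ → q ∈ Lp :=
    forall_mem_of_natAbs_eq_prod_pow Lp [2, 1] hLprime (by decide +kernel)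
  have hbadmem : ∀ ℓ : ℕ, (hℓ : ℓ.Prime) →
      (haveI : Fact ℓ.Prime := ⟨hℓ⟩; ¬ W.HasGoodReductionAtPrime ℓ) → ℓ ∈ Lp := by
    intro ℓ hℓ hbad
    haveI : Fact ℓ.Prime := ⟨hℓ⟩
    have hd := natCast_dvd_minimalDiscriminantInt_of_not_hasGoodReductionAtPrime (W := W) ℓ hbad
    rw [minimalDiscriminantInt_eq hIW] at hd
    exact hΔE ℓ hℓ hd
  have haux : BSTWScope.IsAuxiliaryPrime W 3 43 := by
    refine ⟨by decide, hasMultiplicativeReductionAtPrime_of_intModel hIW 43 (by decide +kernel)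
      (by decide +kernel), ?_⟩
    rw [minimalDiscriminantInt_eq hIW,
      padicValInt_eq_of_dvd_of_not_dvd 43 (e := 2) (by decide +kernel) (by decide +kernel)]
    decide
  refine BSTWScope.hasWitness_of_kronecker W 3 (by decide) 43 haux 47 ⟨by norm_num, ?_, by norm_num⟩
    (by norm_num) (by norm_num) ?_ ?_ (fun _ => by norm_num) ?_
  · exact Int.squarefree_natAbs.mp (by simpa using (by norm_num : Nat.Prime 47).squarefree)
  · intro ℓ hℓ hbad
    have hmem := hbadmem ℓ hℓ hbad
    simp only [hLp, List.mem_cons, List.mem_nil_iff, or_false] at hmem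
    rcases hmem with rfl | rfl <;> decide
  · intro ℓ hℓ hℓq hbad
    have hmem := hbadmem ℓ hℓ hbad
    simp only [hLp, List.mem_cons, List.mem_nil_iff, or_false] at hmem
    rcases hmem with rfl | rfl
    · exact absurd rfl hℓq
    · exact ⟨fun h => absurd h (by decide), fun _ => by norm_num⟩
  · have h5 : Literature.NumberTheory.QuadraticFields.BinaryQuadraticForm.classNumber (-(47 : ℕ) : ℤ) = 5 := by
      decide +kernel
    rw [h5]; decide

/-- **The Eisenstein half of Kobayashi's main conjecture for `4343b1` at `p = 3`, BOTH signs, MODULO ONLY the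
p = 3 tier binder** (`hBSTW : BurungaleSkinnerTianWan2024_thm13_scopedAtThree_OPEN`, PRE resting on (3-ii)♭): the
scope witness is the kernel theorem `BSTWScope_hasWitness_c4343b1_3`, the class is `classX6_c4343b1_3`. One of the 12 A6
cells of the window at `p = 3` (TARGET §1.1). CONDITIONAL on the PRE binder only; per pair; closes nothing; NOT bookable
on cell verification (RELAY-6). [claim: BurungaleSkinnerTianWan2024, status: under-review]
[cite: Cremona2006, Table 1 (Cremona label 4343b1)] -/
theorem kobayashiLowerDivisibility_c4343b1_3_of_thm13_scopedAtThree_OPEN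
    (hBSTW : BurungaleSkinnerTianWan2024_thm13_scopedAtThree_OPEN)
    {W : WeierstrassCurve ℚ} [W.IsElliptic] [W.IsGloballyMinimal]
    (hWeq : W = ⟨0, 0, 1, -325259, -71398995⟩) (ε : ℤˣ) :
    Summit.BirchSwinnertonDyer.Rank1Residual.Supersingular.KobayashiLowerDivisibility W 3 ε :=
  X6.kobayashiLowerDivisibility_of_thm13_scopedAtThree_OPEN W 3 hBSTW rfl (classX6_c4343b1_3 hWeq)
    (BSTWScope_hasWitness_c4343b1_3 hWeq) ε

/-! ### `4963c1 @ 3` -/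

/-- `#Ẽ(𝔽₃) = 4` for `4963c1` (`a₃ = 0`: good SUPERSINGULAR at `3`, and the X6 clause at `p = 3`; kernel count). [folklore] -/
theorem card_c4963c1_3 :
    Nat.card (((⟨1, -1, 0, -236, -1341⟩ : WeierstrassCurve ℤ).map
      (Int.castRingHom (ZMod 3))).toAffine.Point) = 4 :=
  natCard_point_eq_of_countPoints 1 (-1) 0 (-236) (-1341) 3 (by norm_num) (by decide +kernel)
    (by decide +kernel)

/-- `ClassX6 W 3` for `4963c1` read off the integer model (`3 ∤ Δ`, `#Ẽ(𝔽₃) = 4`, `gcd(Δ, c₄) = 1`) by cc-eng-4's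
`classX6_three_of_intModel`. [cite: Cremona2006, Table 1 (Cremona label 4963c1)] [cite: SilvermanAEC2009, VII.5 Prop. 5.1(a) and (b)] -/
theorem classX6_c4963c1_3 {W : WeierstrassCurve ℚ} [W.IsElliptic] [W.IsGloballyMinimal]
    (hWeq : W = ⟨1, -1, 0, -236, -1341⟩) : ClassX6 W 3 := by
  have hIW : integralModelInt W = ⟨1, -1, 0, -236, -1341⟩ :=
    integralModelInt_eq_of_map_eq _ (by rw [hWeq]; ext <;> simp [WeierstrassCurve.map])
  exact classX6_three_of_intModel hIW (by decide +kernel) card_c4963c1_3 (by decide +kernel)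

/-- **L-witness for `4963c1` at `p = 3`: `q = 7`, `L = ℚ(√−95)` (`h = 8`).** `4963c1 = [1, -1, 0, -236, -1341]` (Cremona's minimal model),
`N = 7·709`, `Δ_min = −7·709^2`; the (ram) prime at `3` is `q = 7` (`ord_7 Δ = 1`, `3 ∤ 1`); `−95` is a squarefree (`95 = 5·19`)
fundamental discriminant `≡ 1 (mod 8)` with `(−95/ℓ) = +1` for `ℓ ∈ {3, 709}` (split: `3` and the primes of `N/7`),
`(−95/7) = −1` (inert), `(95, 6N) = 1`, and `h(−95) = 8`, `3 ∤ 8` (form class number by `decide`). Hence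
`BSTWScope.HasWitness W 3`. Unconditional; per pair; closes nothing.
[cite: Cremona2006, Table 1 (Cremona label 4963c1)] [cite: Cox2013, Thm. 2.13 (h(−95) = 8 by reduced forms)] -/
theorem BSTWScope_hasWitness_c4963c1_3 {W : WeierstrassCurve ℚ} [W.IsElliptic] [W.IsGloballyMinimal]
    (hWeq : W = ⟨1, -1, 0, -236, -1341⟩) : BSTWScope.HasWitness W 3 := by
  haveI h7 : Fact (Nat.Prime 7) := ⟨by norm_num⟩
  have hIW : integralModelInt W = ⟨1, -1, 0, -236, -1341⟩ :=
    integralModelInt_eq_of_map_eq _ (by rw [hWeq]; ext <;> simp [WeierstrassCurve.map])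
  set Lp : List ℕ := [7, 709] with hLp
  have hLprime : ∀ q ∈ Lp, q.Prime := by
    simp only [hLp, List.mem_cons, List.mem_nil_iff, or_false]
    rintro q (rfl | rfl) <;> norm_num
  have hΔE : ∀ q : ℕ, q.Prime → (q : ℤ) ∣ (⟨1, -1, 0, -236, -1341⟩ : WeierstrassCurve ℤ).Δ → q ∈ Lp :=
    forall_mem_of_natAbs_eq_prod_pow Lp [1, 2] hLprime (by decide +kernel)
  have hbadmem : ∀ ℓ : ℕ, (hℓ : ℓ.Prime) →
      (haveI : Fact ℓ.Prime := ⟨hℓ⟩; ¬ W.HasGoodReductionAtPrime ℓ) → ℓ ∈ Lp := by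
    intro ℓ hℓ hbad
    haveI : Fact ℓ.Prime := ⟨hℓ⟩
    have hd := natCast_dvd_minimalDiscriminantInt_of_not_hasGoodReductionAtPrime (W := W) ℓ hbad
    rw [minimalDiscriminantInt_eq hIW] at hd
    exact hΔE ℓ hℓ hd
  have haux : BSTWScope.IsAuxiliaryPrime W 3 7 := by
    refine ⟨by decide, hasMultiplicativeReductionAtPrime_of_intModel hIW 7 (by decide +kernel)
      (by decide +kernel), ?_⟩
    rw [minimalDiscriminantInt_eq hIW,
      padicValInt_eq_of_dvd_of_not_dvd 7 (e := 1) (by decide +kernel) (by decide +kernel)]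
    decide
  refine BSTWScope.hasWitness_of_kronecker W 3 (by decide) 7 haux 95 ⟨by norm_num, ?_, by norm_num⟩
    (by norm_num) (by norm_num) ?_ ?_ (fun _ => by norm_num) ?_
  · have hsq : Squarefree ((5 : ℕ) * 19) :=
      (Nat.squarefree_mul (by norm_num)).mpr
        ⟨(by norm_num : Nat.Prime 5).squarefree, (by norm_num : Nat.Prime 19).squarefree⟩
    exact Int.squarefree_natAbs.mp (by simpa using hsq)
  · intro ℓ hℓ hbad
    have hmem := hbadmem ℓ hℓ hbad
    simp only [hLp, List.mem_cons, List.mem_nil_iff, or_false] at hmem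
    rcases hmem with rfl | rfl <;> decide
  · intro ℓ hℓ hℓq hbad
    have hmem := hbadmem ℓ hℓ hbad
    simp only [hLp, List.mem_cons, List.mem_nil_iff, or_false] at hmem
    rcases hmem with rfl | rfl
    · exact absurd rfl hℓq
    · exact ⟨fun h => absurd h (by decide), fun _ => by norm_num⟩
  · have h8 : Literature.NumberTheory.QuadraticFields.BinaryQuadraticForm.classNumber (-(95 : ℕ) : ℤ) = 8 := by
      decide +kernel
    rw [h8]; decide

/-- **The Eisenstein half of Kobayashi's main conjecture for `4963c1` at `p = 3`, BOTH signs, MODULO ONLY the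
p = 3 tier binder** (`hBSTW : BurungaleSkinnerTianWan2024_thm13_scopedAtThree_OPEN`, PRE resting on (3-ii)♭): the
scope witness is the kernel theorem `BSTWScope_hasWitness_c4963c1_3`, the class is `classX6_c4963c1_3`. One of the 12 A6
cells of the window at `p = 3` (TARGET §1.1). CONDITIONAL on the PRE binder only; per pair; closes nothing; NOT bookable
on cell verification (RELAY-6). [claim: BurungaleSkinnerTianWan2024, status: under-review]
[cite: Cremona2006, Table 1 (Cremona label 4963c1)] -/
theorem kobayashiLowerDivisibility_c4963c1_3_of_thm13_scopedAtThree_OPEN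
    (hBSTW : BurungaleSkinnerTianWan2024_thm13_scopedAtThree_OPEN)
    {W : WeierstrassCurve ℚ} [W.IsElliptic] [W.IsGloballyMinimal]
    (hWeq : W = ⟨1, -1, 0, -236, -1341⟩) (ε : ℤˣ) :
    Summit.BirchSwinnertonDyer.Rank1Residual.Supersingular.KobayashiLowerDivisibility W 3 ε :=
  X6.kobayashiLowerDivisibility_of_thm13_scopedAtThree_OPEN W 3 hBSTW rfl (classX6_c4963c1_3 hWeq)
    (BSTWScope_hasWitness_c4963c1_3 hWeq) ε

/-! ### `5561a1 @ 3` -/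

/-- `#Ẽ(𝔽₃) = 4` for `5561a1` (`a₃ = 0`: good SUPERSINGULAR at `3`, and the X6 clause at `p = 3`; kernel count). [folklore] -/
theorem card_c5561a1_3 :
    Nat.card (((⟨1, -1, 0, -121, -408⟩ : WeierstrassCurve ℤ).map
      (Int.castRingHom (ZMod 3))).toAffine.Point) = 4 :=
  natCard_point_eq_of_countPoints 1 (-1) 0 (-121) (-408) 3 (by norm_num) (by decide +kernel)
    (by decide +kernel)

/-- `ClassX6 W 3` for `5561a1` read off the integer model (`3 ∤ Δ`, `#Ẽ(𝔽₃) = 4`, `gcd(Δ, c₄) = 1`) by cc-eng-4's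
`classX6_three_of_intModel`. [cite: Cremona2006, Table 1 (Cremona label 5561a1)] [cite: SilvermanAEC2009, VII.5 Prop. 5.1(a) and (b)] -/
theorem classX6_c5561a1_3 {W : WeierstrassCurve ℚ} [W.IsElliptic] [W.IsGloballyMinimal]
    (hWeq : W = ⟨1, -1, 0, -121, -408⟩) : ClassX6 W 3 := by
  have hIW : integralModelInt W = ⟨1, -1, 0, -121, -408⟩ :=
    integralModelInt_eq_of_map_eq _ (by rw [hWeq]; ext <;> simp [WeierstrassCurve.map])
  exact classX6_three_of_intModel hIW (by decide +kernel) card_c5561a1_3 (by decide +kernel)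

/-- **L-witness for `5561a1` at `p = 3`: `q = 67`, `L = ℚ(√−47)` (`h = 5`).** `5561a1 = [1, -1, 0, -121, -408]` (Cremona's minimal model),
`N = 67·83`, `Δ_min = 67^2·83^2`; the (ram) prime at `3` is `q = 67` (`ord_67 Δ = 2`, `3 ∤ 2`); `−47` is a prime
fundamental discriminant `≡ 1 (mod 8)` with `(−47/ℓ) = +1` for `ℓ ∈ {3, 83}` (split: `3` and the primes of `N/67`),
`(−47/67) = −1` (inert), `(47, 6N) = 1`, and `h(−47) = 5`, `3 ∤ 5` (form class number by `decide`). Hence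
`BSTWScope.HasWitness W 3`. Unconditional; per pair; closes nothing.
[cite: Cremona2006, Table 1 (Cremona label 5561a1)] [cite: Cox2013, Thm. 2.13 (h(−47) = 5 by reduced forms)] -/
theorem BSTWScope_hasWitness_c5561a1_3 {W : WeierstrassCurve ℚ} [W.IsElliptic] [W.IsGloballyMinimal]
    (hWeq : W = ⟨1, -1, 0, -121, -408⟩) : BSTWScope.HasWitness W 3 := by
  haveI h67 : Fact (Nat.Prime 67) := ⟨by norm_num⟩
  have hIW : integralModelInt W = ⟨1, -1, 0, -121, -408⟩ :=
    integralModelInt_eq_of_map_eq _ (by rw [hWeq]; ext <;> simp [WeierstrassCurve.map])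
  set Lp : List ℕ := [67, 83] with hLp
  have hLprime : ∀ q ∈ Lp, q.Prime := by
    simp only [hLp, List.mem_cons, List.mem_nil_iff, or_false]
    rintro q (rfl | rfl) <;> norm_num
  have hΔE : ∀ q : ℕ, q.Prime → (q : ℤ) ∣ (⟨1, -1, 0, -121, -408⟩ : WeierstrassCurve ℤ).Δ → q ∈ Lp :=
    forall_mem_of_natAbs_eq_prod_pow Lp [2, 2] hLprime (by decide +kernel)
  have hbadmem : ∀ ℓ : ℕ, (hℓ : ℓ.Prime) →
      (haveI : Fact ℓ.Prime := ⟨hℓ⟩; ¬ W.HasGoodReductionAtPrime ℓ) → ℓ ∈ Lp := by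
    intro ℓ hℓ hbad
    haveI : Fact ℓ.Prime := ⟨hℓ⟩
    have hd := natCast_dvd_minimalDiscriminantInt_of_not_hasGoodReductionAtPrime (W := W) ℓ hbad
    rw [minimalDiscriminantInt_eq hIW] at hd
    exact hΔE ℓ hℓ hd
  have haux : BSTWScope.IsAuxiliaryPrime W 3 67 := by
    refine ⟨by decide, hasMultiplicativeReductionAtPrime_of_intModel hIW 67 (by decide +kernel)
      (by decide +kernel), ?_⟩
    rw [minimalDiscriminantInt_eq hIW,
      padicValInt_eq_of_dvd_of_not_dvd 67 (e := 2) (by decide +kernel) (by decide +kernel)]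
    decide
  refine BSTWScope.hasWitness_of_kronecker W 3 (by decide) 67 haux 47 ⟨by norm_num, ?_, by norm_num⟩
    (by norm_num) (by norm_num) ?_ ?_ (fun _ => by norm_num) ?_
  · exact Int.squarefree_natAbs.mp (by simpa using (by norm_num : Nat.Prime 47).squarefree)
  · intro ℓ hℓ hbad
    have hmem := hbadmem ℓ hℓ hbad
    simp only [hLp, List.mem_cons, List.mem_nil_iff, or_false] at hmem
    rcases hmem with rfl | rfl <;> decide
  · intro ℓ hℓ hℓq hbad
    have hmem := hbadmem ℓ hℓ hbad
    simp only [hLp, List.mem_cons, List.mem_nil_iff, or_false] at hmem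
    rcases hmem with rfl | rfl
    · exact absurd rfl hℓq
    · exact ⟨fun h => absurd h (by decide), fun _ => by norm_num⟩
  · have h5 : Literature.NumberTheory.QuadraticFields.BinaryQuadraticForm.classNumber (-(47 : ℕ) : ℤ) = 5 := by
      decide +kernel
    rw [h5]; decide

/-- **The Eisenstein half of Kobayashi's main conjecture for `5561a1` at `p = 3`, BOTH signs, MODULO ONLY the
p = 3 tier binder** (`hBSTW : BurungaleSkinnerTianWan2024_thm13_scopedAtThree_OPEN`, PRE resting on (3-ii)♭): the
scope witness is the kernel theorem `BSTWScope_hasWitness_c5561a1_3`, the class is `classX6_c5561a1_3`. One of the 12 A6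
cells of the window at `p = 3` (TARGET §1.1). CONDITIONAL on the PRE binder only; per pair; closes nothing; NOT bookable
on cell verification (RELAY-6). [claim: BurungaleSkinnerTianWan2024, status: under-review]
[cite: Cremona2006, Table 1 (Cremona label 5561a1)] -/
theorem kobayashiLowerDivisibility_c5561a1_3_of_thm13_scopedAtThree_OPEN
    (hBSTW : BurungaleSkinnerTianWan2024_thm13_scopedAtThree_OPEN)
    {W : WeierstrassCurve ℚ} [W.IsElliptic] [W.IsGloballyMinimal]
    (hWeq : W = ⟨1, -1, 0, -121, -408⟩) (ε : ℤˣ) :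
    Summit.BirchSwinnertonDyer.Rank1Residual.Supersingular.KobayashiLowerDivisibility W 3 ε :=
  X6.kobayashiLowerDivisibility_of_thm13_scopedAtThree_OPEN W 3 hBSTW rfl (classX6_c5561a1_3 hWeq)
    (BSTWScope_hasWitness_c5561a1_3 hWeq) ε

/-! ### `8710b1 @ 3` -/

/-- `#Ẽ(𝔽₃) = 4` for `8710b1` (`a₃ = 0`: good SUPERSINGULAR at `3`, and the X6 clause at `p = 3`; kernel count). [folklore] -/
theorem card_c8710b1_3 :
    Nat.card (((⟨1, -1, 0, -76040, -12298944⟩ : WeierstrassCurve ℤ).map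
      (Int.castRingHom (ZMod 3))).toAffine.Point) = 4 :=
  natCard_point_eq_of_countPoints 1 (-1) 0 (-76040) (-12298944) 3 (by norm_num) (by decide +kernel)
    (by decide +kernel)

/-- `ClassX6 W 3` for `8710b1` read off the integer model (`3 ∤ Δ`, `#Ẽ(𝔽₃) = 4`, `gcd(Δ, c₄) = 1`) by cc-eng-4's
`classX6_three_of_intModel`. [cite: Cremona2006, Table 1 (Cremona label 8710b1)] [cite: SilvermanAEC2009, VII.5 Prop. 5.1(a) and (b)] -/
theorem classX6_c8710b1_3 {W : WeierstrassCurve ℚ} [W.IsElliptic] [W.IsGloballyMinimal]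
    (hWeq : W = ⟨1, -1, 0, -76040, -12298944⟩) : ClassX6 W 3 := by
  have hIW : integralModelInt W = ⟨1, -1, 0, -76040, -12298944⟩ :=
    integralModelInt_eq_of_map_eq _ (by rw [hWeq]; ext <;> simp [WeierstrassCurve.map])
  exact classX6_three_of_intModel hIW (by decide +kernel) card_c8710b1_3 (by decide +kernel)

/-- **L-witness for `8710b1` at `p = 3`: `q = 13`, `L = ℚ(√−119)` (`h = 10`).** `8710b1 = [1, -1, 0, -76040, -12298944]` (Cremona's minimal model),
`N = 2·5·13·67`, `Δ_min = −2^36·5^4·13·67`; the (ram) prime at `3` is `q = 13` (`ord_13 Δ = 1`, `3 ∤ 1`); `−119` is a squarefree (`119 = 7·17`)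
fundamental discriminant `≡ 1 (mod 8)` with `(−119/ℓ) = +1` for `ℓ ∈ {3, 2, 5, 67}` (split: `3` and the primes of `N/13`),
`(−119/13) = −1` (inert), `(119, 6N) = 1`, and `h(−119) = 10`, `3 ∤ 10` (form class number by `decide`). Hence
`BSTWScope.HasWitness W 3`. Unconditional; per pair; closes nothing.
[cite: Cremona2006, Table 1 (Cremona label 8710b1)] [cite: Cox2013, Thm. 2.13 (h(−119) = 10 by reduced forms)] -/
theorem BSTWScope_hasWitness_c8710b1_3 {W : WeierstrassCurve ℚ} [W.IsElliptic] [W.IsGloballyMinimal]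
    (hWeq : W = ⟨1, -1, 0, -76040, -12298944⟩) : BSTWScope.HasWitness W 3 := by
  haveI h13 : Fact (Nat.Prime 13) := ⟨by norm_num⟩
  have hIW : integralModelInt W = ⟨1, -1, 0, -76040, -12298944⟩ :=
    integralModelInt_eq_of_map_eq _ (by rw [hWeq]; ext <;> simp [WeierstrassCurve.map])
  set Lp : List ℕ := [2, 5, 13, 67] with hLp
  have hLprime : ∀ q ∈ Lp, q.Prime := by
    simp only [hLp, List.mem_cons, List.mem_nil_iff, or_false]
    rintro q (rfl | rfl | rfl | rfl) <;> norm_num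
  have hΔE : ∀ q : ℕ, q.Prime → (q : ℤ) ∣ (⟨1, -1, 0, -76040, -12298944⟩ : WeierstrassCurve ℤ).Δ → q ∈ Lp :=
    forall_mem_of_natAbs_eq_prod_pow Lp [36, 4, 1, 1] hLprime (by decide +kernel)
  have hbadmem : ∀ ℓ : ℕ, (hℓ : ℓ.Prime) →
      (haveI : Fact ℓ.Prime := ⟨hℓ⟩; ¬ W.HasGoodReductionAtPrime ℓ) → ℓ ∈ Lp := by
    intro ℓ hℓ hbad
    haveI : Fact ℓ.Prime := ⟨hℓ⟩
    have hd := natCast_dvd_minimalDiscriminantInt_of_not_hasGoodReductionAtPrime (W := W) ℓ hbad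
    rw [minimalDiscriminantInt_eq hIW] at hd
    exact hΔE ℓ hℓ hd
  have haux : BSTWScope.IsAuxiliaryPrime W 3 13 := by
    refine ⟨by decide, hasMultiplicativeReductionAtPrime_of_intModel hIW 13 (by decide +kernel)
      (by decide +kernel), ?_⟩
    rw [minimalDiscriminantInt_eq hIW,
      padicValInt_eq_of_dvd_of_not_dvd 13 (e := 1) (by decide +kernel) (by decide +kernel)]
    decide
  refine BSTWScope.hasWitness_of_kronecker W 3 (by decide) 13 haux 119 ⟨by norm_num, ?_, by norm_num⟩
    (by norm_num) (by norm_num) ?_ ?_ (fun _ => by norm_num) ?_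
  · have hsq : Squarefree ((7 : ℕ) * 17) :=
      (Nat.squarefree_mul (by norm_num)).mpr
        ⟨(by norm_num : Nat.Prime 7).squarefree, (by norm_num : Nat.Prime 17).squarefree⟩
    exact Int.squarefree_natAbs.mp (by simpa using hsq)
  · intro ℓ hℓ hbad
    have hmem := hbadmem ℓ hℓ hbad
    simp only [hLp, List.mem_cons, List.mem_nil_iff, or_false] at hmem
    rcases hmem with rfl | rfl | rfl | rfl <;> decide
  · intro ℓ hℓ hℓq hbad
    have hmem := hbadmem ℓ hℓ hbad
    simp only [hLp, List.mem_cons, List.mem_nil_iff, or_false] at hmem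
    rcases hmem with rfl | rfl | rfl | rfl
    · exact ⟨fun _ => by norm_num, fun h => absurd rfl h⟩
    · exact ⟨fun h => absurd h (by decide), fun _ => by norm_num⟩
    · exact absurd rfl hℓq
    · exact ⟨fun h => absurd h (by decide), fun _ => by norm_num⟩
  · have h10 : Literature.NumberTheory.QuadraticFields.BinaryQuadraticForm.classNumber (-(119 : ℕ) : ℤ) = 10 := by
      decide +kernel
    rw [h10]; decide

/-- **The Eisenstein half of Kobayashi's main conjecture for `8710b1` at `p = 3`, BOTH signs, MODULO ONLY the
p = 3 tier binder** (`hBSTW : BurungaleSkinnerTianWan2024_thm13_scopedAtThree_OPEN`, PRE resting on (3-ii)♭): the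
scope witness is the kernel theorem `BSTWScope_hasWitness_c8710b1_3`, the class is `classX6_c8710b1_3`. One of the 12 A6
cells of the window at `p = 3` (TARGET §1.1). CONDITIONAL on the PRE binder only; per pair; closes nothing; NOT bookable
on cell verification (RELAY-6). [claim: BurungaleSkinnerTianWan2024, status: under-review]
[cite: Cremona2006, Table 1 (Cremona label 8710b1)] -/
theorem kobayashiLowerDivisibility_c8710b1_3_of_thm13_scopedAtThree_OPEN
    (hBSTW : BurungaleSkinnerTianWan2024_thm13_scopedAtThree_OPEN)
    {W : WeierstrassCurve ℚ} [W.IsElliptic] [W.IsGloballyMinimal]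
    (hWeq : W = ⟨1, -1, 0, -76040, -12298944⟩) (ε : ℤˣ) :
    Summit.BirchSwinnertonDyer.Rank1Residual.Supersingular.KobayashiLowerDivisibility W 3 ε :=
  X6.kobayashiLowerDivisibility_of_thm13_scopedAtThree_OPEN W 3 hBSTW rfl (classX6_c8710b1_3 hWeq)
    (BSTWScope_hasWitness_c8710b1_3 hWeq) ε

end Summit.BirchSwinnertonDyer.BirchSwinnertonDyer.Theorems

end
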